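import Mathlib
import HarnessLib
import HarnessLib.Audit
import Summits.PneNP.Statement
import Literature.Computability.ImplicitComplexity.SoftProgramInterpretation
import Literature.Computability.Complexity.CNF
import Literature.Computability.Complexity.NPBridge
import Literature.Computability.Complexity.ClayProblem
import Literature.Computability.Complexity.NegCNFTranscoder

/-!
Route: LightLogic

CLOSED (exhausted) 2026-08-16T05:43:57Z by planner-rchoice-PneNP-LightLogic-stmt-PneNP-14-c961d3d6-0 — reason: exhausted — note: CENSUS (route-choice after the SUBSTANTIVE refutation of crux #4 OracleRefusal, stmt-PneNP-14658, refuter rattack-14658, 2026-08-16T05:18Z; closed as exhausted because the gate reserves closed_as=refuted for a LANDED refuting theorem and the Lean not-decl is one definer lemma (W) away — in substance. The file is kept as the record of this route; refuted decls are indexed as negative knowledge (`ledger negatives`).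

"Guessing cannot be eliminated from soft proofs" (card PneNP/PneNP/light-logic-sum-conservativity).
It suffices to show X: for every level t ∈ ℕ, the satisfiability language SAT ⊆ {0,1}*
(Literature.Computability.Complexity.SAT) is decided by NO closed sum-free program ⊢ M : !ⁿ S_m ⊸ B
of Gaboardi–Ronchi Della Rocca's soft type assignment system STA — the λ-calculus form of Lafont's
soft linear logic — of level max d(Π) n ≤ t (degree of the typing derivation ≤ t and ≤ t promotions
of the input word; acceptance s ∈ L ⟺ M s̲ →β* 0): the definer's calibration
`Literature.Computability.ImplicitComplexity.SoftRepresentsAtLevel` (Gaboardi–Marion–Ronchi Della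
Rocca 2008 Def. 3.8; LANDED 2026-08-15), equivalently — not formalised — cut-free uSLL nets of
Laurent–Tortora de Falco 2006 Def. 9–11 of the word→boolean type with box-nesting depth ≤ t.
Lean: `∀ t : ℕ, ¬ Literature.Computability.ImplicitComplexity.SoftRepresentsAtLevel t
Literature.Computability.Complexity.SAT` (target item Thesis, typed since rev 4).
Why X ⟺ P ≠ NP: soft programs represent exactly the P languages (Lafont 2004,
doi:10.1016/j.tcs.2003.10.018; GMR08 doi:10.1016/j.entcs.2008.03.066 Thm 3.5 + 3.9; LTdF 2006
doi:10.1109/lics.2006.37 Prop. 7; named Literature fact STACapturesP), and soft programs + the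
nondeterministic SUM rule (from M : A and N : A infer M + N : A, reducing to either) represent
exactly NP (GMR08 Thm 5.12 + 5.14, named fact STAPlusCapturesNP; Maurel 2003,
doi:10.1007/3-540-44904-3_17, for light affine logic). Hence P = NP ⟺ SUM is conservative over the
deterministic system for closed word→boolean programs (up to a change of level), and X is that
non-conservativity. Only P-completeness of the deterministic system is load-bearing for X → PneNP.
Deciding theorem (rev 4; kernel-checked, axioms propext/Classical.choice/Quot.sound): `closes (hX :
Thesis) (hP : SoftCapturesP) : PneNP`, where the support item SoftCapturesP is the completeness half
`∀ L ∈ Classes.P, ∃ t, SoftRepresentsAtLevel t L` (GMR08 Thm 3.9 / Lafont 2004 Thm 9), restated as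
the route's own item so that the cone carries no cite-only fact; proof: SAT ∈ NP Bool by the proved
bridges np_bool_eq and SAT_mem_NP_holds, and SAT ∈ P Bool = Classes.P (P_bool_eq_holds) would give a
level representing SAT, contradicting X. The Assembly item is the same implication `Thesis →
SoftCapturesP → PneNP`.

Rationale: WHY THIS LINE. (widen: proof theory of linear logic + denotational semantics, "implicit complexity";
card light-logic-sum-conservativity) P vs NP becomes a cut-elimination question inside ONE typed
logic: can nondeterministic choice be eliminated from soft proofs at polynomial cost in level? Proof
theory separates such extensions by MODELS, and for soft linear logic a semantic normal-form theorem
is IN PRINT: in the multiset relational model a cut-free LL net is a soft (polytime) net iff its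
interpretation is an OBSESSIONAL clique — closed under the action x ↦ (x)_t^(k) of the monoid (ℕ*,·)
that multiplies large multiplicities (Laurent–Tortora de Falco 2006 = LTdF, Def. 13, Thm. 4
"relative completeness"). Polynomial time so acquires a syntax-free invariant (closure of a set of
points under a monoid action) on which induction over points and levels is available, and a lower
bound becomes a NON-DEFINABILITY statement: no admissible clique decides SAT. LTdF prove only
RELATIVE completeness, state that full completeness fails in Rel (§1, §5.3), and name the missing
piece: "a property both ABSOLUTE for complexity and relatively complete" (§6). That open problem —
not full completeness of a game model as the card proposed — is the heart of this route; being a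
DIRECTIVE and not a proposition (crux-attack rattack-14539, 2026-08-16) it is carried under NOT
DECOMPOSED YET, and its decidable content for finiteness-type tameness is crux #3 NoFinitaryAbsolute
(rev-11 repair). The card's LAL/nLAL formulation (doi:10.1006/inco.1998.2700,
doi:10.1145/504077.504081, doi:10.1007/3-540-44904-3_17) is equivalent in content, but LTdF §6 flag
LLL as out of reach of obsessionality, so the route fixes the SOFT system
(doi:10.1016/j.tcs.2003.10.018, doi:10.1007/978-3-540-74915-8_21, doi:10.1016/j.entcs.2008.03.066)
and keeps LAL + discreet games (doi:10.1007/3-540-44622-2_29) as the reserve model. Imported areas: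
linear-logic proof nets and soft/light logics; relational semantics and experiments (LTdF; de
Carvalho–Pagani–TdF doi:10.1016/j.tcs.2010.12.017, a semantic MEASURE of execution time; Ehrhard
finiteness spaces doi:10.1017/s0960129504004645 as candidate tameness); low-rung "evaluate in a
model the target violates" bounds (doi:10.1109/lics.1996.561337, doi:10.4230/lipics.icalp.2020.135).
Objects: no existence is smuggled in — NoFinitaryAbsolute DENIES absoluteness to a whole axiomatised
class of tameness properties (interface side), OracleRefusal tests the one canonical finitary
candidate (construction side), and a future named tameness F₀ enters only as an explicit item Shell
F₀ e₀ (sound ∧ absolute ∧ composable for that defined F₀), never as ∃F. State of the vocabulary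
(2026-08-16, rev 6): the calculus STA/STA₊ with levels (SoftTypeAssignment: SoftRepresentsAtLevel,
SoftSumRepresentsAtLevel), the space D with the ℕ*-action and obsessionality (ObsessionalCliques,
ObsessionalCliqueSaturation), the word→boolean interfaces (CliqueDecides; STA-native
URel.STADecides) and the interpretation ⟦·⟧ of STA derivations in D (SoftProgramInterpretation:
STA.Deriv, STA.Deriv.rank, softness theorem obsessionalFrom_softProgramInterpretation with threshold
max 1 rk(Π)) have LANDED; adequacy/invariance of ⟦·⟧ (LTdF Thm 3 for this reading) is not proved; NO
tameness predicate has landed, the first candidate Φ⁰ is dead (rev 6), and since the rev-11 repair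
crux #3 is the typed dichotomy NoFinitaryAbsolute.
RANKED CRUXES. #2 SoftCapturesP (support, TYPED rev 4: `∀ L ∈ Classes.P, ∃ t, SoftRepresentsAtLevel
t L`) — the completeness half of "STA captures P" (GMR08 Thm 3.9: a polynomially clocked decider
becomes ⊢ DTM_P : !ⁿ S ⊸ B with n depending on the degree of the clock only; Lafont 2004 Thm 9), the
load-bearing hypothesis of `closes`; in print, to be proved in Theorems over Mathlib's FinTM2
deciders or derived from a future STACapturesP_holds (why it might fail as stated: the simulation of
multi-stack FinTM2 machines must be redone in STA and the level must depend on k alone). #3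
NoFinitaryAbsolute (crux, TYPED by the rev-11 repair; replaces AbsoluteObsessionalityR =
stmt-PneNP-14539, itself the rev-6 informal repair of AbsoluteObsessionality = stmt-PneNP-1863
(rattack-1863: M1 bare ∃Φ witnessed by the image of syntax, M2 threshold = rank not level, M3 tables
/ 'Ehrhard-finitary' undefined); crux-attack rattack-14539, 2026-08-16, verdict refuted-MISSTATED:
(F1, kernel typedShell_iff) the typed shell ∃F g,(a′)(b′)(c′) ⟺ ∃g ∀t Absolute(SynClosure g t) — ∃F
carries no tameness content; (F2) 'F DEFINED FROM THE STRUCTURE OF D ALONE' is void —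
presentation-level, and under definability over (D; ⊗,⅋,!,?, ℕ*-action) the image of syntax
qualifies; (F3) LTdF §6 is a directive — its literal existence form is settled by LTdF Thm 3 + Thm 4
+ Prop 7 and only NATURALITY is open, not a proposition; (F4) interface drift
CliqueDecides/STADecides; (F5) the obsessionality conjunct is idle). The decidable content kept as
the crux is the refuter's C′1 = necessary condition (n2) = the first kill criterion as a Prop, flat
and level by level: for every t ≥ 1, NO family F ⊆ 𝒫(D) that is (a′) sound (∋ ⟦Π⟧ for every closed
sum-free Π ▹ ⊢ M : !ⁿS_m ⊸ B with d ≤ t, n ≤ t, m ≥ 1), hereditary and closed under binary unions —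
every Ehrhard finiteness structure through the programs, and the ideal they generate — is (b′)
absolute for any exponent e: some member, obsessional from some threshold, STADecides (m ≥ 1) a
language outside DTIME(k^e); (c′) is not assumed (stronger without it). Expected TRUE by the keyed
tables inside ⟦Π_0⟧ ∪ ⟦Π_1⟧ — VETTED 2026-08-16: at the CliqueDecides interface with two untyped
depth-1 oblivious-READER nets R_b it is TRUE (refuter rattack-1863-g4: kernel tableClique O ⊆
readerRows tt ∪ readerRows ff, oracleComplete_of_hereditary_unionClosed,
finitenessStructure_not_absolute; one paper step readerRows b ⊆ ⟦R_b⟧; caveats: the containing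
programs must READ every letter — constant programs λs.b have only uniform keys — and the typed
STA-native reader Step := λc.λz.ΛY'.λy. z [Y'⊸Y'] (c [Y'⊸Y'] I I) y is not kernel-checked), and at
this item's STADecides interface the mechanism (α) containment by softness, (β) rigid keys, (γ)
coverage of every derivation via adequacy + injective re-threading shows no gap (refuter
rattack-14539, EVIDENCE.md v2 §6: prover-scale, not refuter-cheap) (CHEAPEST FALSIFIER;
kernel-checked wiring in the repair planner's Sketch.lean: the F = univ instance follows from
TablesAtSTAInterface and exists_mem_P_not_mem_DTIME_pow, and ¬OracleRefusal gives the instance at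
the syntactic-finiteness ideal); PROVED ⇒ the finitary branch is dead (KILL CRITERIA); REFUTED ⇒ an
absolute finitary tameness exists at some level and is filed as the named F₀ of C′3 (Shell F₀ e₀).
The necessary conditions recorded on stmt-14539 stand for any future F₀: (n1) reject the tables —
typed support TableCliquesDecideAll (CliqueDecides interface) and, rev-11 repair,
TablesAtSTAInterface (STADecides interface, refuter's C′2); (n2) = this item; (n3) multiset
coherence admits tables keyed on pairwise strictly incoherent principal points (paper, to be
vetted); (n4) monotone closure axioms never exclude the image of syntax; rank ↦ obsessionality
threshold and level ↦ time exponent stay independent (a program's rank is a constant, time ≈ (input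
rank)^(depth)), so any F₀ is indexed by the level. #4 OracleRefusal (crux, TYPED rev 9 by the
route-repair of stmt-PneNP-1864 → stmt-PneNP-14658) — the admission test INSTANTIATED at the one
canonical finiteness-type F: c obsessional from some threshold ∧ finitary for the finiteness
structure on D GENERATED BY SYNTAX at the type !ⁿS_m ⊸ B ((u ∩ c) finite for every u ⊆ D that meets
every sum-free program interpretation of that type finitely — the least finiteness structure making
programs finitary, so (a′) is automatic and, being minimal, it speaks for every finiteness structure
containing the programs); claim: no such c STADecides (m ≥ 1) a language of EXP ∖ P; first
formulation only, O pinned to a class, the 'saturate the graph of χ_O' clause withdrawn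
(not_cliqueDecides_graph). This is the INSTANCE of #3 at the canonical F (the CliqueDecides
prototype of the mechanism is oracleComplete_of_ideal, LANDED,
Theorems/OracleRefusal/Negative/TableClique.lean): its REFUTATION — expected, through the keyed rows
of the programs Π_b of CHEAPEST FALSIFIER — proves #3 at F = the ideal generated by the syntactic
finiteness structures of all program types (an EXP ∖ P oracle lies outside every DTIME(k^e) ⊆ P;
kernel-checked in the repair planner's Sketch.lean) and, that structure being least, speaks against
every finiteness structure containing the programs, while a PROOF would reopen the finitary
candidate as the first refusing P-sound model; strictly weaker than absoluteness (b′);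
oracle-completeness for every natural F discards the relational branch by Baker–Gill–Solovay. #5
SatNotInLinearTime and #6 NondetLinearNotInDetQuadratic (cruxes, TYPED) — the TM shadows any proof
of X must cast first (rung 1 of the level ladder; level-1 non-conservativity in DTIME/NTIME): open
uniform fixed-polynomial statements beyond Paul–Pippenger–Szemerédi–Trotter; ranked low — they are
where the semantic method must first beat diagonalization, and they calibrate honesty. Support (rank
9): TableCliquesDecideAll (TYPED rev 6: `∀ O, ∃ c, URel.ObsessionalFrom 0 c ∧ URel.CliqueDecides 1 c
O` — the refuter's Lean theorem, to be landed in Theorems; negative anchor of #3/#4);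
TablesAtSTAInterface (TYPED, rev-11 repair, refuter's C′2: `∀ O m, 1 ≤ m → ∃ c, URel.ObsessionalFrom
1 c ∧ URel.STADecides 0 m c O` — the same tables at the STA-native interface of #3/#4, keys in ⟦w̲⟧
over ALL derivations of the word; prover-scale, gives the F = univ instance of #3); SumCapturesNP
(TYPED rev 4 as the body of STAPlusCapturesNP: NP side of the equivalence, types ¬X as sum
elimination); LowLevelRegular (informal — CALIBRATION NOTE for tenure: at the definer's level 0, d =
0 ∧ n = 0, no judgement with a right-modal type is derivable without (sp), so the input s : S_m can
never be applied and level-0 programs cannot read the word: "level 0 ⇒ regular" is true but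
degenerate; restate at level 1 — one fold of degree-0 step functions over the word, Nguyễn–Pradic
doi:10.4230/lipics.icalp.2020.135 dictionary — before typing); NPNotInLinearTime (TYPED; in tree as
exists_mem_NP_not_mem_DTIME_id per grounder g15-24). Target Thesis TYPED rev 4; Assembly = Thesis →
SoftCapturesP → PneNP, provable verbatim by the proof of `closes`.
KILL CRITERIA. OracleRefusal refuted for every tameness candidate tried (finitary, coherent,
size-tame) ⇒ relational branch dead: pivot to the games model in one tenure pass or close exhausted
with census. NoFinitaryAbsolute PROVED — it IS the strong form "no hereditary ∪-closed sound
(finitary-type) tameness is absolute for P", i.e. the refutation of absolute obsessionality for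
every finiteness-structure candidate at once ⇒ the relational-finitary branch is dead: in ONE tenure
pass either name a non-monotone / effectivity-type F₀ passing (n1)–(n4) and file Shell F₀ e₀ (sound
∧ absolute ∧ composable for that NAMED, DEFINED F₀ — never ∃F), or pivot #3/#4 to the games branch,
else close exhausted with census, recording NoFinitaryAbsolute as negative knowledge on Rel-based
ICC semantics. NoFinitaryAbsolute REFUTED is not a kill: an absolute finitary tameness then exists
at some level — file it as F₀ and build the separation argument on it. SatNotInLinearTime or
NondetLinearNotInDetQuadratic refuted ⇒ P = NP-type collapse, summit moot. Thesis refuted (some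
level represents SAT) ⇒ P = NP by STA soundness (GMR08 Thm 3.5), summit moot. SoftCapturesP is in
print; if its formalisation over STA stalls two tenure passes, split it (clocked-TM encoding /
iteration lemma / acceptance) rather than weaken it. STATUS 2026-08-16 (rev 6): of the tameness
candidates named at open, size-tame and plain-obsessional are refuted (tables, Lean),
'Ehrhard-finitary' is undefined on D and — by the hereditary+∪ argument (n2), now the typed crux #3
NoFinitaryAbsolute (rev-11 repair), pending its proof — unusable in any form, and multiset coherence
falls to the same tables (n3, pending): if (n2) and (n3) are confirmed the first kill criterion
FIRES (every candidate tried is oracle-complete) and tenure must, in ONE pass, either name a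
non-monotone/effectivity-type F that passes (n1)–(n4) or pivot #3/#4 to the games branch
(Murawski–Ong discreet games; Dal Lago–Laurent) — else close exhausted with census. Thesis,
SoftCapturesP, the deciding theorem and the TM rungs #5/#6 are model-independent and unaffected.
NOT DECOMPOSED YET. The separation argument proper (logical relation / counting experiments against
χ_SAT) below #3; rungs t ≥ 2; the games branch (Murawski–Ong; Dal Lago–Laurent quantitative games
doi:10.1007/978-3-540-87531-4_18); coherent instead of relational semantics; additives; syntactic
sum elimination beyond ¬X; parsimonious/P-poly variants (doi:10.1007/978-3-662-47666-6_28);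
Seiller's graphings (doi:10.1016/j.apal.2016.10.007) as an alternative semantic lower-bound
technology; the soundness half of STACapturesP (not load-bearing for X → PneNP). Also not
decomposed: the LTdF §6 DIRECTIVE itself ('find a property both absolute for complexity and
relatively complete', doi:10.1109/lics.2006.37 §6, PDF p.10) — a research directive, not a
proposition (crux-attack rattack-14539 F3: its literal ∃-form is settled by the image of syntax,
kernel typedShell_iff; only naturality is open); it re-enters the route only as an item Shell F₀ e₀
:= (a′) sound ∧ (b′) absolute ∧ (c′) compose/feed-closed for a NAMED, DEFINED tameness F₀ (refuter's
C′3), never as ∃F, and the choice of F₀ is open-ended — effectivity-type tameness (resource-bounded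
realisability, Dal Lago–Hofmann doi:10.1016/j.tcs.2010.12.025 — absolute by fiat, no invariant) or a
genuinely non-monotone / finiteness-of-information condition — refuter rattack-1863-g4
(EVIDENCE-g4.md §6.4): a viable tameness is neither hereditary-and-∪-closed nor blind to rigid-key
tables, e.g. closure under INVERSE dilation (a de-dilation test: tables are dilation-closed upward
only) or type-indexed logical relations instead of properties of bare cliques — all to be tested
first against (n1)–(n4); and adequacy/invariance of ⟦·⟧ (a definer/prover item the day an F₀ or the
proof of #3 needs it).
CHEAPEST FALSIFIER. DONE for the rev-5 candidate (2026-08-16): the table clique T_O is consistent at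
the interface and obsessional from 0 for EVERY O (Lean), size-tame, and 'Ehrhard-finitary' has no
meaning on D — Φ⁰ is dead. NEXT cheapest check (paper, an hour): (n2) for the level-1 programs Π_b
:= λw. (Par (Copy w)) b b — Copy w = w [λℓ y. ℓ cons0 cons1 y]^! nil rebuilds the word while
INSPECTING each letter (selector labels, disjoint zero/oneClique) with injective cons-threading, Par
folds the copy with λℓ y. (ℓ NOT ID) y, and `r b b` makes the output a point of ⟦b⟧ whatever r is
while keeping the folds DEMANDED (pitfall: in the affine relational reading a discarded computation
vanishes from ⟦Π⟧ — input label ![] — so 'traverse then ignore' programs have no keys) — verify that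
⟦Π_b⟧ contains, for every word w and every β ∈ ⟦b⟧, an entry V_{w,β}^⊥ ⅋ β whose key V_{w,β} ∈
argClique 0 ⟦w̲⟧ lies in argClique 0 ⟦w̲'⟧ for no w' ≠ w and whose dilations are keys of no word
(injective threading, x_0 ≠ x_n) — then every hereditary ∪-closed F ∋ ⟦Π_0⟧, ⟦Π_1⟧ contains an
obsessional table for every O (STADecides 0 m), which retires ALL finiteness-structure candidates
and fires the first kill criterion — in Lean this is crux #3 NoFinitaryAbsolute (typed, rev-11
repair; ¬OracleRefusal, #4, proves its instance at the syntactic-finiteness ideal), and the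
free-standing table at the STA interface is support TablesAtSTAInterface; (n3) check that principal
word points with a fixed incoherent pair a ⌣ b as boolean labels are pairwise strictly incoherent in
W, making every keyed table a clique of the multiset coherence space. Either check failing would
REOPEN the corresponding candidate.
DEFINITION REQUESTS. (i) ⟦·⟧ — LANDED (SoftProgramInterpretation, 2026-08-15/16; adequacy w.r.t.
STADecides not proved, wanted only when #3 has an F). (ii) 'Ehrhard-finitary / size-tame predicates
on cliques of D' — WITHDRAWN as stated (rev 6): size-tameness admits the tables, and a finiteness
structure on D is either unspecified (M3) or, whichever is chosen, oracle-complete by (n2); no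
definition is requested until a candidate F₀ is proposed on paper (that proposal is the
NOT-DECOMPOSED LTdF §6 directive; it would be filed as Shell F₀ e₀). Wanted instead, prover-side:
land the refuter's table theorem (support TableCliquesDecideAll) and its STA-interface analogue
(support TablesAtSTAInterface, rev-11 repair) next to CliqueDecides/SoftProgramInterpretation. The
typed #4 INLINES the syntactic finiteness predicate (named SynFinitary, with its one-line
soundness/hereditary/∪ lemmas, in the repair planner's Sketch.lean attached to stmt-PneNP-14658); no
Literature definition is requested for it unless #4 survives its crux-attack.
SOURCES. doi:10.1109/lics.2006.37; doi:10.1016/j.tcs.2003.10.018; doi:10.1007/978-3-540-74915-8_21;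
doi:10.1016/j.entcs.2008.03.066; doi:10.1007/3-540-44904-3_17; doi:10.1006/inco.1998.2700;
doi:10.1145/504077.504081; doi:10.1007/3-540-44622-2_29; doi:10.1016/j.tcs.2010.12.017;
doi:10.1017/s0960129504004645; doi:10.1109/lics.1996.561337; doi:10.4230/lipics.icalp.2020.135;
doi:10.1109/sfcs.1983.39; doi:10.1145/1101821.1101822; doi:10.1561/0400000012;
doi:10.1016/j.apal.2012.01.004; doi:10.1016/j.tcs.2010.12.025; doi:10.1007/11590156_15.

Novelty: Search-before-claim (this session, 2026-08-15): lit galaxy search --star all x6 ("soft linear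
logic", "light affine logic", "obsessional", "parsimonious types", "semantic lower bounds", "Lower
Bounds for Satisfiability"); READ in full Laurent–Tortora de Falco 2006 from the LICS 2006
proceedings (lit galaxy read panama:371256973066251, Def. 1–15, Thm 1–4, Prop. 7–8, §6) and Williams
"Automated proofs of time lower bounds" pp.1–4 (pdf:2968178060: PPST NTIME[n] ⊄ DTIME[n (log*
n)^1/4]; strongest model with non-trivial SAT time bounds = random-access input + n^o(1) store + one
sequential tape); crossref/zbMATH x16 (OpenAlex/S2/arXiv HTTP 429 today); lit frontier PneNP --since
2020 and lit bridges PneNP --cross any (no implicit-complexity row among 60); plus the card's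
searches and two refuter audits (grade new-combination, confirmed 2026-08-15).
Nearest prior art FOUND: (i) capture theorems making "P = NP ⟺ sum is conservative" immediate —
doi:10.1016/j.tcs.2003.10.018 (Lafont, SLL = P), doi:10.1016/j.entcs.2008.03.066
(Gaboardi–Marion–Ronchi Della Rocca, STA+ = NP), doi:10.1007/3-540-44904-3_17 (Maurel, nLAL = NP,
frames nLAL vs LAL as P vs NP), doi:10.1007/978-3-540-74915-8_21 (STA), doi:10.1006/inco.1998.2700,
doi:10.1145/504077.504081; (ii) the semantic normal form — doi:10.1109/lics.2006.37 (obsessional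
cliques: RELATIVE completeness for uSLL; full completeness fails in Rel; open problem "absolute for
complexity" posed in §6); (iii) semantics that MEASURES time but bounds no  [refs: 10.1016/j.tcs.2003.10.018, 10.1016/j.entcs.2008.03.066, 10.1007/3-540-44904-3_17, 10.1007/978-3-540-74915-8_21, 10.1006/inco.1998.2700, 10.1145/504077.504081, 10.1109/lics.2006.37, 10.1016/j.tcs.2010.12.017, 10.1145/1555746.1555749, 10.1007/978-3-540-87531-4_18, 10.1007/978-3-540-79709-8_16, 10.1016/j.tcs.2010.12.025, 10.1016/j.apal.2016.10.007, 10.1007/978-3-662-47666-6_28, 10.1109/lics.1996.5613]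

Barriers (technique_class: implicit-complexity, linear-logic, semantic-non-definability): technique_class: implicit-complexity, linear-logic, semantic-non-definability
- Literature.Barriers.PneNP.Relativization: APPLIES at thesis level — X ⟺ P ≠ NP through
SoftCapturesP, so a proof of X composes to a proof of PneNP and cannot relativize
(Relativization.not_relativizes_pneNP_shape). Intended evasion, filed as a test not a claim: an
oracle O enters the calculus only as a new axiom link c_O : W ⊸ B; the separating property Φ_t must
REFUSE such constants for some O (crux OracleRefusal), i.e. Φ_t reads the multiplicity structure of
points, not input–output behaviour. If instead every c_O is admitted at some level
(oracle-completeness), any semantic separation lemma would give P^O ≠ NP^O for all O, contradicting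
Literature.Computability.Complexity.baker_gill_solovay_eq — the candidate model is then discarded
(kill criterion).
- Literature.Barriers.PneNP.BoundedRelativization: same status; the collapsing oracle may be
PSPACE-complete and dense, and the admission test quantifies over arbitrary language oracles, dense
ones included.
- Literature.Barriers.PneNP.Algebrization: same inheritance; nothing in the line arithmetises, and a
low-degree-extension oracle is again a constant the model must refuse.
- Literature.Barriers.PneNP.NaturalProofs: does NOT apply formally — X is a uniform statement about
nets (finite proofs) and Φ_t is a property of cliques (sets of points recording multiplicities of an
interaction), not a property of truth tables; no P/poly-constructive large

History (route lifecycle, newest last):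
- 2026-08-15T16:20:55Z · rev 4: restated Assembly (stmt-PneNP-1640) — route-repair (glue): Thesis/SoftCapturesP/SumCapturesNP typed over the landed SoftRepresentsAtLevel/SoftSumRepresentsAtLevel (set-signature stmt-PneNP-1861/1862 (planner-rbadge-PneNP-LightLogic-774cbff7-g2-0)
- 2026-08-16T04:08:34Z · rev 7: dropped stmt-PneNP-1863 — route-repair (refuted-misstated crux), step 2/2: DROP stmt-PneNP-1863 AbsoluteObsessionality (informal, no decl; attacked by refuter rattack-1863: M1 bare ∃Φ tr (planner-rrefute-PneNP-LightLogic-stmt-PneNP-18-7f150f27-0)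
- 2026-08-16T04:09:03Z · AUTO-CRUX (edit): Thesis — hypotheses of the deciding theorem that nothing in the route derives are cruxes (planner-rrefute-PneNP-LightLogic-stmt-PneNP-18-7f150f27-0)
- 2026-08-16T04:19:08Z · rev 9: restated OracleRefusal (stmt-PneNP-1864) — @note.txt (planner-rrefute-PneNP-LightLogic-stmt-PneNP-18-be0fa3f6-0)
- 2026-08-16T04:57:55Z · rev 11: restated AbsoluteObsessionalityR (stmt-PneNP-14539) — repair: AbsoluteObsessionalityR (stmt-PneNP-14539, informal crux #3) refuted-MISSTATED by crux-attack rattack-14539 (F1 typedShell_iff: ∃F idle; F2 'F defined f (planner-rrefute-PneNP-LightLogic-stmt-PneNP-14-201fbf89-0)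
- 2026-08-16T05:43:57Z · CLOSED exhausted — exhausted (planner-rchoice-PneNP-LightLogic-stmt-PneNP-14-c961d3d6-0)

sub-problem: PneNP · status: closed(exhausted) · opened planner-plancard-PneNP-PneNP-light-logic-sum--22954c8a-0 2026-08-15T10:57:47Z · rev 11 · ledger route-PneNP-LightLogic
GENERATED by the gate from the ledger (D-0016/17). Provers cite these decls: `theorem foo : Summit.PneNP.PneNP.Theses.LightLogic.<Decl> := …` in Summits/PneNP/PneNP/Theorems/<Name>.lean.
-/

namespace Summit.PneNP.PneNP.Theses.LightLogic

open scoped BigOperators Topology Manifold Classical MeasureTheory ProbabilityTheory Matrix InnerProductSpace ComplexConjugate ContinuousMap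
open Filter Set Function TopologicalSpace MeasureTheory

attribute [summit_statement] _root_.PneNP

open Literature.PNP

/-- item stmt-PneNP-1861 · crux (kind.auto-crux: conjecture-grade) · rank 0 · closed · moot by None · by planner
why it might fail: X ⟺ P ≠ NP given SoftCapturesP, so X is false iff P = NP. It can also fail by CALIBRATION: Lafont's completeness (Thm 9) needs deg P+deg Q+1 input copies and box depth growing with the degree; were 'level' to fix input multiplicity or count multiplexor rank, P ⊄ ⋃_t level t.
sources: doi:10.1016/j.tcs.2003.10.018, doi:10.1109/lics.2006.37, doi:10.1016/j.entcs.2008.03.066, doi:10.1007/3-540-44904-3_17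
[target] Route thesis X of PneNP/LightLogic (informal until SoftRepresentsAtLevel lands): for every
t : ℕ, SAT (Literature.Computability.Complexity.SAT) is not represented at level t by any cut-free
proof net of soft linear logic (uSLL, Laurent–Tortora de Falco 2006 Def. 9–11; equivalently a closed
STA term, Gaboardi–Ronchi Della Rocca 2007) of the word→boolean type — intended Lean `∀ t : ℕ, ¬
SoftRepresentsAtLevel t Literature.Computability.Complexity.SAT`. Equivalent to P ≠ NP given
SoftCapturesP (both directions) and to non-conservativity of the SUM rule given SumCapturesNP. NEEDS
DEFINITION: SoftRepresentsAtLevel. -/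
@[route_item "route-PneNP-LightLogic"]
def Thesis : Prop :=
  ∀ t : ℕ, ¬ Literature.Computability.ImplicitComplexity.SoftRepresentsAtLevel t Literature.Computability.Complexity.SAT

/-- item stmt-PneNP-1862 · crux · rank 2 · closed · moot by None · by planner
why it might fail: Mathematically in print; can fail only AS STATED over the tree's model: the simulation of Mathlib multi-stack FinTM2 deciders (input popped from a stack, answer via encodeBool) by soft nets must be redone, and 'level' must be box depth so that t depends on k alone (multiplexing width would not do).
sources: doi:10.1016/j.tcs.2003.10.018, doi:10.1109/lics.2006.37, doi:10.1007/978-3-540-74915-8_21, doi:10.1016/j.entcs.2008.03.066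
[crux] LITERATURE FACT TO LAND FIRST (plancard rule; it is the Assembly's first hypothesis, and the
level calibration every other item uses). (i) Completeness, load-bearing: every L ∈
Literature.Computability.Complexity.Classes.P (FinTM2 deciders in time c·n^k + c) is represented by
a cut-free uSLL net / closed STA term of the word→boolean type at some level t ≤ g(k) (Lafont 2004
doi:10.1016/j.tcs.2003.10.018, P-time completeness via encoding of polynomially clocked TMs;
Gaboardi–Ronchi Della Rocca 2007 doi:10.1007/978-3-540-74915-8_21, FPTIME completeness of STA;
Laurent–Tortora de Falco 2006 Prop. 7 for uSLL). (ii) Soundness with explicit calibration: level-t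
representable ⇒ L ∈ DTIME(n^{f t}) with f stated (Lafont 2004: nets of depth d normalise in a number
of steps polynomial with degree governed by d; GR07 polynomial soundness). Intended Lean, as two
Literature facts with _holds: `∀ L ∈ Classes.P, ∃ t, SoftRepresentsAtLevel t L` and `∀ t L,
SoftRepresentsAtLevel t L → L ∈ DTIME (fun n => n ^ f t)`. NEEDS DEFINITION: SoftRepresentsAtLevel. -/
@[route_item "route-PneNP-LightLogic"]
def SoftCapturesP : Prop :=
  ∀ L ∈ Literature.Computability.Complexity.Classes.P, ∃ t : ℕ, Literature.Computability.ImplicitComplexity.SoftRepresentsAtLevel t L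

/-- item stmt-PneNP-14650 · crux · rank 3 · closed · moot by None · by planner
why it might fail: Needs keyed tables INSIDE ⟦Π_0⟧∪⟦Π_1⟧: keys unambiguous across words and across ALL derivations of ⊢w̲:S_m (weakened copies put ![] into labels), exact answers ⟦0⟧/⟦1⟧ on every derivation (adequacy of ⟦·⟧ unproved), dilations harmless; if keys collide, the programs' ideal may be absolute.
sources: doi:10.1109/lics.2006.37, doi:10.1017/s0960129504004645, doi:10.1016/j.entcs.2008.03.066, Summit.PneNP.PneNP.Theorems.OracleRefusal.Negative.oracleComplete_of_ideal, Literature.Computability.Complexity.exists_mem_P_not_mem_DTIME_pow, Literature.Computability.Complexity.baker_gill_solovay_eq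
[crux] NO FINITARY TAMENESS IS ABSOLUTE (rev-11 repair; replaces AbsoluteObsessionalityR =
stmt-PneNP-14539, refuted-MISSTATED by crux-attack rattack-14539, 2026-08-16: (F1, kernel
typedShell_iff) the typed shell ∃F g, (a′)∧(b′)∧(c′) ⟺ ∃g ∀t Absolute(SynClosure) — the
compose/feed-closure of the image of level-t syntax is the least sound composable family, so ∃F has
no tameness content; (F2) 'F defined from the structure of D alone' is void — presentation-level,
and under definability over (D; ⊗,⅋,!,?, ℕ*-action) the image of syntax qualifies; (F3) LTdF §6 is a
DIRECTIVE whose literal existence form is settled by LTdF Thm 3 + Thm 4 + Prop 7, only naturality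
being open; (F4) (n1) sat at CliqueDecides while (b′) speaks STADecides; (F5) the obsessionality
conjunct is idle). This item is the refuter's repaired C′1 = the planner's necessary condition (n2)
= the route's first kill criterion AS A PROPOSITION, level by level and flat (F t ↦ F and g t ↦ e
occur only through their values at t): for every level t ≥ 1, every family F ⊆ 𝒫(D) that is (a′)
SOUND — contains ⟦Π⟧ for every closed sum-free program derivation Π ▹ ⊢ M : !ⁿS_m ⊸ B with d ≤ t, n
≤ t, m ≥ 1 — HEREDITARY (sub-cliques) and -/
@[route_item "route-PneNP-LightLogic"]
def NoFinitaryAbsolute : Prop :=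
  ∀ t : ℕ, 1 ≤ t → ∀ (F : Set (Set Literature.Computability.ImplicitComplexity.URel.Point)) (e : ℕ), (∀ (d n m : ℕ) (M : Literature.Computability.ImplicitComplexity.STA.Term) (D : Literature.Computability.ImplicitComplexity.STA.Deriv d Literature.Computability.ImplicitComplexity.STA.Ctx.empty M (Literature.Computability.ImplicitComplexity.STA.progTy n m)), M.SumFree → d ≤ t → n ≤ t → 1 ≤ m → Literature.Computability.ImplicitComplexity.SoftProgramInterpretation D ∈ F) → (∀ c c' : Set Literature.Computability.ImplicitComplexity.URel.Point, c' ⊆ c → c ∈ F → c' ∈ F) → (∀ c c' : Set Literature.Computability.ImplicitComplexity.URel.Point, c ∈ F → c' ∈ F → c ∪ c' ∈ F) → ¬ (∀ c ∈ F, (∃ s : ℕ, Literature.Computability.ImplicitComplexity.URel.ObsessionalFrom s c) → ∀ (n m : ℕ) (L : Language Bool), 1 ≤ m → Literature.Computability.ImplicitComplexity.URel.STADecides n m c L → L ∈ Literature.Computability.Complexity.DTIME (fun k => k ^ e))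

-- earlier OracleRefusal (stmt-PneNP-1864, replaced 2026-08-16T04:19:08Z -> stmt-PneNP-14658): retired by None — [crux] Admission test — the cheapest decisive experiment, to be settled FIRST among the semantic items (refuter audit-15's recommendation on the card). For the named candidate Φ⁰_t of AbsoluteObsessionality: there is a language O ⊆ {0,1}* (wlog O ∈ EXP ∖ P by the time hierarchy, or a gener
/-- item stmt-PneNP-14658 · crux · rank 4 · closed · moot by None · by planner
why it might fail: Likely FALSE, decisively: an STA program reading every letter while threading a growing counter, answering constantly, has rigid word rows; rows picked by χ_O from it and its 1-answering twin give a finitary obsessional decider of ANY O (oracleComplete_of_ideal). Vacuous if no clique STADecides.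
sources: doi:10.1109/lics.2006.37, doi:10.1017/s0960129504004645, doi:10.1016/j.entcs.2008.03.066, Summit.PneNP.PneNP.Theorems.OracleRefusal.Negative.oracleComplete_of_ideal, Literature.Computability.Complexity.baker_gill_solovay_eq
[crux] Admission test — REPAIRED 2026-08-16 (route-repair after crux-attack rattack-1864, verdict
refuted-misstated; negative side LANDED in
Summits/PneNP/PneNP/Theorems/OracleRefusal/Negative/TableClique.lean:
not_oracleRefusal_plainObsessional — the distinct-label table clique decides EVERY language at the
URel.CliqueDecides interface and is t-obsessional for every t, so the plain-obsessionality reading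
is false; not_cliqueDecides_graph — the old clause 'equivalently, saturating the graph of χ_O breaks
consistency' is degenerate and is WITHDRAWN; oracleComplete_of_ideal — every sub-clique- and
finite-union-closed property admitting the tables of the two trivial languages is oracle-complete;
size-tameness cannot separate, table rows have genuine cardinalities). First formulation only, O
pinned to the class EXP ∖ P, at the STA-native interface (URel.STADecides n m, m ≥ 1 so that every
word is a datum; GMR08 data), for the CANONICAL reading of the candidate Φ⁰: c obsessional from some
threshold (program interpretations are obsessional from max 1 rk Π,
obsessionalFrom_softProgramInterpretation — threshold = rank, not level) AND finitary for the
Ehrhard finiteness structure on D GENER -/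
@[route_item "route-PneNP-LightLogic"]
def OracleRefusal : Prop :=
  ∀ (n m : ℕ), 1 ≤ m → ∀ c : _root_.Set Literature.Computability.ImplicitComplexity.URel.Point, (∀ u : _root_.Set Literature.Computability.ImplicitComplexity.URel.Point, (∀ (d : ℕ) (M : Literature.Computability.ImplicitComplexity.STA.Term) (D : Literature.Computability.ImplicitComplexity.STA.Deriv d Literature.Computability.ImplicitComplexity.STA.Ctx.empty M (Literature.Computability.ImplicitComplexity.STA.progTy n m)), M.SumFree → (u ∩ Literature.Computability.ImplicitComplexity.SoftProgramInterpretation D).Finite) → (u ∩ c).Finite) → (∃ t : ℕ, Literature.Computability.ImplicitComplexity.URel.ObsessionalFrom t c) → ∀ O : Language Bool, O ∈ Literature.Computability.Complexity.EXP → O ∉ Literature.Computability.Complexity.Classes.P → ¬ Literature.Computability.ImplicitComplexity.URel.STADecides n m c O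

/-- item stmt-PneNP-1641 · crux · rank 5 · closed · moot by None · by planner
why it might fail: False iff SAT ∈ DTIME(n) on multi-stack TMs (⇒ P = NP); nothing known excludes it: SAT is NQL-complete only modulo polylog (Schnorr78, Cook88), so PPST's NTIME(n) ⊄ DTIME(n(log* n)^{1/4}) does not transfer; Santhanam01 gives only time·space ≥ n²/polylog; n^{1+ε} bounds need small space or one tape.
sources: doi:10.1109/sfcs.1983.39, doi:10.1145/1101821.1101822, doi:10.1561/0400000012, doi:10.1016/s0020-0190(00)00227-1, doi:10.1145/322047.322060, doi:10.1109/ccc.2005.6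
[crux] Rung 1 of the level ladder, TM shadow: SAT (the tree's encoding of CNFs) is not decidable in
deterministic LINEAR time on Mathlib multi-stack machines (DTIME t = ∃ c, TimeClass (c·t n + c)). A
necessary consequence of X (X ⇒ SAT ∉ P) and the first unconditional statement any uniform method
must deliver beyond Paul–Pippenger–Szemerédi–Trotter 1983 (NTIME(n) ⊄ DTIME(n (log* n)^{1/4}) for
multitape TMs, doi:10.1109/sfcs.1983.39), whose separation does not transfer to SAT (NTIME(n) → SAT
reductions cost n·polylog); every SAT time lower bound ≥ n^{1+ε} in print needs a space or tape
restriction (Fortnow–Lipton–van Melkebeek–Viglas doi:10.1145/1101821.1101822; van Melkebeek's survey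
doi:10.1561/0400000012; Williams: the strongest model with non-trivial SAT time bounds is
random-access input + n^{o(1)} store + one sequential tape). Ranked low on purpose: it is where the
semantic method ('no admissible clique of the level that soft soundness maps into DTIME(n) decides
SAT') must first beat diagonalization; it also dedups with any other uniform route reaching the same
rung. -/
@[route_item "route-PneNP-LightLogic"]
def SatNotInLinearTime : Prop :=
  Literature.Computability.Complexity.SAT ∉ Literature.Computability.Complexity.DTIME (fun n => n)

/-- item stmt-PneNP-1642 · crux · rank 6 · closed · moot by None · by planner
why it might fail: False only if NTIME(n) ⊆ DTIME(n²) (⇒ NP ⊆ P by padding); nothing known excludes it: best is NTIME(n) ⊄ DTIME(n(log* n)^{1/4}) via the Σ₄ speed-up of sequential tapes (PPST83), extended by Santhanam (CCC'01) only to t = o(n log* n); no technique in print reaches a polynomial gap.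
sources: doi:10.1109/sfcs.1983.39, doi:10.1561/0400000012, doi:10.1145/301250.301424, doi:10.1109/ccc.2001.933895, arXiv:2111.02138
[crux] Level-1 non-conservativity, TM shadow: nondeterministic linear time (verifier-form NTIME n of
the tree) is not contained in deterministic QUADRATIC time on multi-stack machines. A necessary
consequence of PneNP by padding (NTIME(n) ⊆ DTIME(n²) ⇒ NTIME(n^k) ⊆ DTIME(O(n^{2k})) ⇒ NP ⊆ P) and
the quantitative form of 'SUM at soft level 1 is not eliminable into deterministic level 2': the
calibration in SoftCapturesP/SumCapturesNP maps nondeterministic level 1 onto a class ⊇ NTIME(n) and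
deterministic level 2 into DTIME(n^{f 2}). Known only with (log* n)^{1/4} in place of n (PPST 1983
for multitape TMs, doi:10.1109/sfcs.1983.39; transfers to FinTM2 by real-time tape/stack
simulation); for linear-time RAMs see Ajtai doi:10.1145/301250.301424. Distinct in shape from
SatNotInLinearTime (class vs fixed language; the two are equivalent only up to the n·polylog
Cook–Levin loss). -/
@[route_item "route-PneNP-LightLogic"]
def NondetLinearNotInDetQuadratic : Prop :=
  ¬ (Literature.Computability.Complexity.NTIME (fun n => n) ⊆ Literature.Computability.Complexity.DTIME (fun n => n ^ 2))

/-- item stmt-PneNP-14548 · support · rank 9 · closed · moot by None · by planner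
sources: doi:10.1109/lics.2006.37, Literature.Computability.Complexity.baker_gill_solovay_eq
[support] TABLE CLIQUES DECIDE EVERYTHING (negative knowledge, Lean-proved by refuter rattack-1863
as URel.exists_obsessionalFrom_zero_cliqueDecides, Evidence1863.lean v2, lean check rc 0, 0 sorry,
standard axioms; to be landed in Theorems or vendored next to CliqueDecides.lean): for every
language O ⊆ {0,1}* there is a clique c ⊆ D, obsessional from 0 (hence from every s), that decides O
at the Lafont word→boolean interface with one input copy — the table clique T_O = ℕ*-saturation of
the rows {p_w^⊥ ⅋ β : β ∈ ⟦χ_O(w)⟧}, p_w a principal point of ⟦w̄⟧ with injective threading (its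
dilations are points of no word, so T_O stays consistent). Consequences recorded on the route: plain
obsessionality (and dCPT size-tameness: T_O has linear size growth) is ORACLE-COMPLETE, so
OracleRefusal (stmt-PneNP-1864) is false for plain obsessionality and any tameness F of
AbsoluteObsessionalityR (stmt-PneNP-14539) must reject T_O for O ∉ P (necessary condition n1); by
Baker–Gill–Solovay no separation can come from obsessionality alone. The same keyed-row construction
is expected at the STA-native interface URel.STADecides (keys V_w ∈ argClique n ⟦w̲⟧; not yet
checked in Lean). Needs import Literatu -/
@[route_item "route-PneNP-LightLogic"]
def TableCliquesDecideAll : Prop :=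
  ∀ O : Language Bool, ∃ c : Set Literature.Computability.ImplicitComplexity.URel.Point, Literature.Computability.ImplicitComplexity.URel.ObsessionalFrom 0 c ∧ Literature.Computability.ImplicitComplexity.URel.CliqueDecides 1 c O

/-- item stmt-PneNP-14656 · support · rank 9 · closed · moot by None · by planner
sources: doi:10.1109/lics.2006.37, doi:10.1016/j.entcs.2008.03.066, Summit.PneNP.PneNP.Theorems.OracleRefusal.Negative.oracleComplete_plainObsessional
[support] TABLES AT THE STA INTERFACE (refuter's C′2, rev-11 repair; the (n1) anchor of #3 at the
items' own interface — TableCliquesDecideAll is at URel.CliqueDecides 1 with LTdF data W, this one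
at URel.STADecides 0 m with GMR08 data S_m, no promotion of the input): for every language O ⊆
{0,1}* and every m ≥ 1 there is a clique c ⊆ D, obsessional from threshold 1 (a row (![a])^⊥ ⅋ β is
moved by the t-action only through a and β once t ≥ 1, act_bang1), deciding O: the keyed table
{(![a])^⊥ ⅋ β : a ∈ Key_w, β ∈ ⟦0⟧ if w ∈ O / ⟦1⟧ if w ∉ O}, Key_w ⊆ ⋃_D ⟦D⟧ (D over ALL derivations
of ⊢ w̲ : S_m) the points lying in the interpretation of no derivation of another word, closed under
dilation. Prover-scale inversion lemma, expected TRUE (refuter rattack-14539 types it and reports a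
kernel lemma not_absolute_of_tables: tables ⇒ ¬absolute). Consequences: plain obsessionality is
oracle-complete at the STA interface too; any tameness named for LTdF §6 must reject these c (n1);
with exists_mem_P_not_mem_DTIME_pow it gives the F = univ instance of crux NoFinitaryAbsolute
(planner Sketch.lean, Lean). Could fail as stated only if some word owns no unambiguous key in some
derivation D of w̲ (de -/
@[route_item "route-PneNP-LightLogic"]
def TablesAtSTAInterface : Prop :=
  ∀ (O : Language Bool) (m : ℕ), 1 ≤ m → ∃ c : Set Literature.Computability.ImplicitComplexity.URel.Point, Literature.Computability.ImplicitComplexity.URel.ObsessionalFrom 1 c ∧ Literature.Computability.ImplicitComplexity.URel.STADecides 0 m c O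

/-- item stmt-PneNP-1643 · support · rank 9 · closed · moot by None · by planner
sources: doi:10.1109/sfcs.1983.39
[support] Calibration item (known result, not a crux): some NP language is not decidable in
deterministic linear time — Paul–Pippenger–Szemerédi–Trotter 1983, NTIME(n) ⊄ DTIME(n (log*
n)^{1/4}) for multitape TMs (doi:10.1109/sfcs.1983.39); over the tree's FinTM2 multi-stack machines
it follows by real-time simulation of stacks by tapes (constant factors are absorbed by DTIME).
Wanted twice: as a Literature fact (classical proof), and as the FIRST TEST of the semantic method —
a proof that no admissible low-level clique decides the PPST language would be the first evidence
that obsessionality-type invariants can reproduce a diagonalization-based uniform separation. -/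
@[route_item "route-PneNP-LightLogic"]
def NPNotInLinearTime : Prop :=
  ∃ L ∈ Literature.Computability.Complexity.Nondeterministic.NP, L ∉ Literature.Computability.Complexity.DTIME (fun n => n)

/-- item stmt-PneNP-1865 · support · rank 9 · closed · moot by None · by planner
sources: doi:10.1016/j.entcs.2008.03.066, doi:10.1007/3-540-44904-3_17
[support] NP side of the equivalence (makes X ⟺ P ≠ NP ⟺ non-conservativity of SUM, and types the
negative side ¬X as 'sum elimination with bounded level blow-up'): a language is in
Literature.Computability.Complexity.Nondeterministic.NP iff it is ACCEPTED at some level by a soft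
net/term extended with the nondeterministic sum rule (t + u : A from t, u : A; t + u → t and t + u →
u; accept w iff some reduction of the cut against w̄ normalises to tt) — Gaboardi–Marion–Ronchi
Della Rocca 2008 (STA+ characterises NP, doi:10.1016/j.entcs.2008.03.066), Maurel 2003
(nondeterministic light logics = NP, doi:10.1007/3-540-44904-3_17). Intended Lean: `∀ L, L ∈
Nondeterministic.NP ↔ ∃ t, SoftSumRepresentsAtLevel t L`. NEEDS DEFINITION:
SoftSumRepresentsAtLevel. -/
@[route_item "route-PneNP-LightLogic"]
def SumCapturesNP : Prop :=
  ∀ L : Language Bool, L ∈ Literature.Computability.Complexity.Nondeterministic.NP ↔ ∃ t : ℕ, Literature.Computability.ImplicitComplexity.SoftSumRepresentsAtLevel t L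

/-- item stmt-PneNP-1866 · support · rank 9 · closed · moot by None · by planner
sources: doi:10.1109/lics.1996.561337, doi:10.4230/lipics.icalp.2020.135
[support] Bottom rung, provable by 'evaluation in a finite model' once the definitions land — the
first exercise in the tree of semantics as a lower-bound device: every language represented by a
soft net of level 0 (no box around the uses of the input word; the definer's lowest level) is
REGULAR — recognised by the finite monoid obtained by interpreting the net in the relational model
over a finite web (or in finite sets-and-relations); hence {0^n 1^n} and SAT are not level-0
representable. Pattern: Hillebrand–Kanellakis (simply typed λ-definable languages = regular,
doi:10.1109/lics.1996.561337); Nguyen–Pradic (implicit automata in linear/affine λ-calculi,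
doi:10.4230/lipics.icalp.2020.135). If the definer's level 0 already iterates over the word
non-linearly, restate for the largest level whose nets evaluate in a finite model. NEEDS DEFINITION:
SoftRepresentsAtLevel. -/
@[route_item "route-PneNP-LightLogic"]
def LowLevelRegular : Prop :=
  ∀ L : Language Bool, Literature.Computability.ImplicitComplexity.SoftRepresentsAtLevel 0 L → L.IsRegular

-- earlier Assembly (stmt-PneNP-1640, replaced 2026-08-15T16:20:55Z -> stmt-PneNP-10668): retired by None — ∀ Represents : ℕ → Language Bool → Prop, (∀ L ∈ Literature.Computability.Complexity.Classes.P, ∃ t, Represents t L) → Literature.Computability.Complexity.P_bool_eq → Literature.Computability.Complexity.NP_bool_eq → Literature.Computability.Complexity.SAT_mem_NP → (∀ t, ¬ Represents t Literature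
/-- item stmt-PneNP-10668 · assembly · rank 1 · closed · moot by None · by planner
sources: doi:10.1016/j.tcs.2003.10.018, doi:10.1109/lics.2006.37
[assembly] Honest shape after the definition package landed
(Literature.Computability.ImplicitComplexity.SoftTypeAssignment): the thesis X (target item Thesis:
∀ t, ¬ SoftRepresentsAtLevel t SAT) and the completeness half of the capture theorem (support item
SoftCapturesP: Classes.P ⊆ ⋃_t level-t soft-representable; Gaboardi–Marion–Ronchi Della Rocca 2008
Thm 3.9, Lafont 2004 Thm 9) give PneNP through the PROVED bridges np_bool_eq (NPBridge),
SAT_mem_NP_holds (NegCNFTranscoder), P_bool_eq_holds (ClayProblem): SAT ∈ NP Bool, and SAT ∈ P Bool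
= Classes.P would give a level representing SAT, contradicting X. This is exactly the route's
deciding theorem `closes (hX : Thesis) (hP : SoftCapturesP) : PneNP` (kernel-checked, axioms
propext/Classical.choice/Quot.sound); provable verbatim by the same 8-line proof (planner folder
Sketch.lean, theorem Assembly_candidate). Supersedes the schematic `∀ Represents, …` form, whose
unlisted hypotheses P_bool_eq/NP_bool_eq/SAT_mem_NP the glue lint flagged. -/
@[route_item "route-PneNP-LightLogic"]
def Assembly : Prop :=
  Thesis → SoftCapturesP → PneNP

-- records of items no longer active in this route (dropped / restated):
-- earlier AbsoluteObsessionalityR (stmt-PneNP-14539, replaced 2026-08-16T04:57:55Z -> stmt-PneNP-14650): retired by None — [crux] ABSOLUTE OBSESSIONALITY, restated (repairs stmt-PneNP-1863 after crux-attack rattack-1863, misstated M1–M3). LTdF §6 verbatim: find "a property which is both absolute for complexity (any element of the model satisfying the property would be in a given complexity class, th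

end Summit.PneNP.PneNP.Theses.LightLogic
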